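import Mathlib
import Summits.Ventures.PercRepro2.HCov
import Summits.Ventures.PercRepro2.GcInterior
import Summits.Ventures.PercRepro2.GcSkelReductionMinH

/-!
# Rational weights suffice: `HCov_all ℝ ↔ HCov_all ℚ` (blind cell PercRepro2, typer-1 g55)

`Gc` is a polynomial in the weights with integer coefficients, so a ring homomorphism `f : R →+* S`
carries `Gc` at `p` to `Gc` at `f ∘ p` (`prob_map`, **`Gc_map`**). For the cast `ℚ → R` this makes
(HCOV) at a rational weight vector the same statement over `ℚ` and over `R` (`HCov_cast_iff`), so
`HCov_all R → HCov_all ℚ` for every ordered field `R` (`HCov_all_rat_of_HCov_all`); and when `R`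
is Archimedean the rational points of the open cube are dense in the closed cube, so the closed
set `{p | 0 ≤ Gc p}` (`isClosed_HCov`) contains the whole cube as soon as it contains them:
`HCov_all ℚ → HCov_all R` (`HCov_all_of_HCov_all_rat`). Hence

* **`HCov_all_iff_rat`**: `HCov_all R ↔ HCov_all ℚ` for every Archimedean ordered field, and
  **`HCov_all_real_iff_rat`**: `HCov_all ℝ ↔ HCov_all ℚ`;
* **`HCov_all_real_iff_HCovWRedMinH_int_all_rat`**: the crux over `ℝ` is (HCOV) on the class of
  record at RATIONAL weights in `(0, 1)^E` — exactly the instances the engine evaluates exactly.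
-/

namespace Summit.Ventures.PercRepro2

open CovForm

/-! ## Ring homomorphisms carry the masses -/

section Map

variable {E : Type*} [Fintype E] [DecidableEq E] {R : Type*} {S : Type*} [CommRing R] [CommRing S]

omit [Fintype E] [DecidableEq E] in
/-- The edge factor commutes with a ring homomorphism. -/
lemma edgeFactor_map (f : R →+* S) (q : R) (b : Bool) :
    edgeFactor (f q) b = f (edgeFactor q b) := by
  cases b
  · simp only [edgeFactor_false, map_sub, map_one]
  · rfl

omit [DecidableEq E] in
/-- The weight of a configuration commutes with a ring homomorphism. -/
lemma weight_map (f : R →+* S) (p : E → R) (ω : Config E) :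
    weight (fun e => f (p e)) ω = f (weight p ω) := by
  unfold weight
  rw [map_prod]
  exact Finset.prod_congr rfl fun e _ => edgeFactor_map f (p e) (ω e)

/-- The probability of an event commutes with a ring homomorphism. -/
lemma prob_map (f : R →+* S) (p : E → R) (A : Set (Config E)) :
    prob (fun e => f (p e)) A = f (prob p A) := by
  unfold prob
  rw [map_sum]
  refine Finset.sum_congr rfl fun ω _ => ?_
  by_cases h : ω ∈ A
  · rw [Set.indicator_of_mem h, Set.indicator_of_mem h, weight_map]
  · rw [Set.indicator_of_notMem h, Set.indicator_of_notMem h, map_zero]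

end Map

section GcMap

variable {V : Type*} {E : Type*} [Fintype E] [DecidableEq E] {R : Type*} {S : Type*}
  [Field R] [LinearOrder R] [Field S] [LinearOrder S]

omit [LinearOrder R] [LinearOrder S] in
/-- **`Gc` commutes with a ring homomorphism** (it is a polynomial in the weights with integer
coefficients). -/
theorem Gc_map (f : R →+* S) (p : E → R) (ends : E → Sym2 V) (o a₁ a₂ a₃ b : V) :
    Gc (fun e => f (p e)) ends o a₁ a₂ a₃ b = f (Gc p ends o a₁ a₂ a₃ b) := by
  simp only [Gc, EQbo, EQb3, EQb3o, EQo, EQ3, EQ3o, PDb, PDbo, Do, gap, DEF, prob_map, map_add,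
    map_sub, map_mul]

end GcMap

/-! ## The cast `ℚ → R` -/

section Rat

variable {V : Type*} {E : Type*} [Fintype E] [DecidableEq E] {R : Type*} [Field R]
  [LinearOrder R] [IsStrictOrderedRing R]

/-- (HCOV) at a rational weight vector, read over `R` or over `ℚ`. -/
theorem HCov_cast_iff (p : E → ℚ) (ends : E → Sym2 V) (o a₁ a₂ a₃ b : V) :
    HCov (fun e => (p e : R)) ends o a₁ a₂ a₃ b ↔ HCov p ends o a₁ a₂ a₃ b := by
  unfold HCov
  have h := Gc_map (Rat.castHom R) p ends o a₁ a₂ a₃ b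
  simp only [Rat.coe_castHom] at h
  rw [h, Rat.cast_nonneg]

omit [Fintype E] [DecidableEq E] in
/-- The cast of an admissible rational weight vector is admissible. -/
lemma isProbVec_cast {p : E → ℚ} (hp : IsProbVec p) : IsProbVec fun e => (p e : R) :=
  ⟨fun e => Rat.cast_nonneg.2 (hp.nonneg e), fun e => by exact_mod_cast hp.le_one e⟩

end Rat

section Closure

variable (R : Type*) [Field R] [LinearOrder R] [IsStrictOrderedRing R]

/-- **`HCov_all R → HCov_all ℚ`** for every ordered field `R`. -/
theorem HCov_all_rat_of_HCov_all (h : HCov_all R) : HCov_all ℚ := by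
  intro V E _ _ _ _ ends p hp o a₁ a₂ a₃ b h1 h2 h3 h4 h5 h6 h7 h8 h9 h10
  exact (HCov_cast_iff (R := R) p ends o a₁ a₂ a₃ b).1
    (h V E ends (fun e => (p e : R)) (isProbVec_cast hp) o a₁ a₂ a₃ b h1 h2 h3 h4 h5 h6 h7 h8 h9
      h10)

/-- **`HCov_all ℚ → HCov_all R`** for every Archimedean ordered field `R`: the rational points of
the open cube are dense in the closed cube and `{p | 0 ≤ Gc p}` is closed. -/
theorem HCov_all_of_HCov_all_rat [Archimedean R] (h : HCov_all ℚ) : HCov_all R := by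
  intro V E _ _ _ _ ends p hp o a₁ a₂ a₃ b h1 h2 h3 h4 h5 h6 h7 h8 h9 h10
  letI : TopologicalSpace R := Preorder.topology R
  haveI : OrderTopology R := ⟨rfl⟩
  have hcl : IsClosed {q : E → R | HCov q ends o a₁ a₂ a₃ b} := isClosed_HCov ends o a₁ a₂ a₃ b
  have hsub : Set.pi Set.univ (fun _ : E => Set.Ioo (0 : R) 1 ∩ Set.range ((↑) : ℚ → R)) ⊆
      {q : E → R | HCov q ends o a₁ a₂ a₃ b} := by
    intro q hq
    rw [Set.mem_univ_pi] at hq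
    choose r hr using fun e => (hq e).2
    have hq' : q = fun e => (r e : R) := funext fun e => (hr e).symm
    have hr' : IsProbVec r := by
      refine ⟨fun e => ?_, fun e => ?_⟩
      · have := (hq e).1.1
        rw [← hr e, Rat.cast_pos] at this
        exact this.le
      · have h1 : (r e : R) < 1 := by rw [hr e]; exact (hq e).1.2
        have h2 : r e < 1 := by exact_mod_cast h1
        exact h2.le
    rw [Set.mem_setOf_eq, hq', HCov_cast_iff]
    exact h V E ends r hr' o a₁ a₂ a₃ b h1 h2 h3 h4 h5 h6 h7 h8 h9 h10
  have hmem : p ∈ closure (Set.pi Set.univ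
      (fun _ : E => Set.Ioo (0 : R) 1 ∩ Set.range ((↑) : ℚ → R))) := by
    rw [closure_pi_set, Set.mem_univ_pi]
    intro e
    have hdense : Set.Ioo (0 : R) 1 ⊆ closure (Set.Ioo (0 : R) 1 ∩ Set.range ((↑) : ℚ → R)) :=
      Rat.denseRange_cast.open_subset_closure_inter isOpen_Ioo
    have hIcc : Set.Icc (0 : R) 1 ⊆ closure (Set.Ioo (0 : R) 1 ∩ Set.range ((↑) : ℚ → R)) := by
      rw [← closure_Ioo zero_ne_one]
      exact closure_minimal hdense isClosed_closure
    exact hIcc ⟨hp.nonneg e, hp.le_one e⟩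
  exact hcl.closure_subset_iff.2 hsub hmem

/-- **Rational weights suffice**: `HCov_all R ↔ HCov_all ℚ` for every Archimedean ordered
field. -/
theorem HCov_all_iff_rat [Archimedean R] : HCov_all R ↔ HCov_all ℚ :=
  ⟨HCov_all_rat_of_HCov_all R, HCov_all_of_HCov_all_rat R⟩

end Closure

section Real

/-- **`HCov_all ℝ ↔ HCov_all ℚ`.** -/
theorem HCov_all_real_iff_rat : HCov_all ℝ ↔ HCov_all ℚ :=
  HCov_all_iff_rat ℝ

/-- **THE CRUX OVER `ℝ` IS (HCOV) ON THE CLASS OF RECORD AT RATIONAL WEIGHTS IN `(0, 1)^E`** —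
the instances the engine evaluates exactly. -/
theorem HCov_all_real_iff_HCovWRedMinH_int_all_rat :
    HCov_all ℝ ↔ WRed.HCovWRedMinH_int_all ℚ :=
  HCov_all_real_iff_rat.trans (WRed.HCov_all_iff_HCovWRedMinH_int_all (R := ℚ))

end Real

end Summit.Ventures.PercRepro2
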